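import Mathlib.Analysis.Calculus.MeanValue
import Mathlib.Analysis.Calculus.Deriv.Mul
import Mathlib.Analysis.Calculus.Deriv.Star
import Mathlib.Analysis.Complex.RealDeriv
import Literature.Analysis.ODE.ComplexOverRealBasis
import Literature.Analysis.ODE.DiagonalKernelMaximum
import HarnessLib

/-!
# Complex solutions of a real second-order equation over a conjugate pair:
# constant amplitudes, flux and Wronskian factorisation, the small-gain lower bound

Topic `Literature/Analysis/ODE` (namespace `Literature.Analysis.ODE`, short names grouped under
`ConjugatePair.…`), companion of `ComplexOverRealBasis.lean`. For the REAL equation `y″ = q(x) y`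
(`q : ℝ → ℝ`, any sign) on `[α, β]`, the complex conjugate `ē` of a COMPLEX solution `e` is again a
solution, and `W(e, ē) = e ē′ − e′ ē = −2i·Im(ē e′)` is `−2i` times the conserved flux of `e`. When
`e` CARRIES FLUX (`f_e = Im(ē e′) ≠ 0`; think of the two travelling waves `x^{−1/2 ∓ iδ}` of an
inverse-square throat) the pair `e, ē` is fundamental and every complex solution has CONSTANT
amplitudes over it. Everything here is elementary and fully proved, with the pointwise `HasDerivAt`
hypotheses of `ComplexOverRealBasis.lean` (`u u′ e e′ : ℝ → ℂ`):

* `ConjugatePair.conj_sol` — `ē` solves the same equation (the coefficient is real);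
* `ConjugatePair.wronskian_self_conj`, `ConjugatePair.norm_wronskian_self_conj` — the algebra
  `e ē′ − e′ ē = −2i Im(ē e′)`, `|e ē′ − e′ ē| = 2|Im(ē e′)|`;
* `ConjugatePair.decomp` — **`u = A e + A′ ē`, `u′ = A e′ + A′ ē′` on `[α, β]`** with the constant
  amplitudes `A = W(u, ē)(α)/W(e, ē)(α)`, `A′ = W(e, u)(α)/W(e, ē)(α)`; proved from the constancy
  of the three Wronskians (`wronskian_complex_const` of `DiagonalKernelMaximum.lean`, which is
  REUSED, not restated) and the reconstruction identity (`mul_wronskian_eq` of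
  `ComplexOverRealBasis.lean` with `g, d ↦ e, ē`) — no uniqueness theorem is invoked;
  `ConjugatePair.flux_eq` — the flux of `u` is `(|A|² − |A′|²)·f_e`;
* `ConjugatePair.flux_decomp` — pure algebra: `Im(conj(A e + A′ ē)(A e′ + A′ ē′)) = (|A|² − |A′|²)
  Im(ē e′)` (the cross terms are complex conjugate); read as amplitude ratios this is
  `ConjugatePair.gain_sq_eq` (`|A/A′|² = 1 + F/(f_e |A′|²)`, "reflection with gain" when the flux
  `F` of the combination has the sign of `f_e`) and `ConjugatePair.reflection_sq_eq`
  (`|D/C|² = 1 − G/(f_e |C|²)`);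
* `ConjugatePair.wronskian_decomp`, `ConjugatePair.norm_wronskian_decomp` — pure algebra:
  **`W(A e + A′ ē, C e + D ē) = (A D − A′ C)·W(e, ē)`**, `|W| = |A D − A′ C|·2|f_e|` (the
  conjugate-pair instance of `wronskian_of_combinations`, `BarrierTwoPoint.lean`);
* `ConjugatePair.norm_det_ge`, `ConjugatePair.small_gain` — the triangle lower bounds
  `|A′||C| − |A||D| ≤ |A D − A′ C|`, `|A||D| − |A′||C| ≤ |A D − A′ C|` and the SMALL-GAIN form
  `|A′||C|·(1 − |A/A′|·|D/C|) ≤ |A D − A′ C|`;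
* `ConjugatePair.norm_wronskian_eq`, `ConjugatePair.norm_wronskian_ge_small_gain` — the assembled
  statements for two complex solutions `u = A e + A′ ē`, `v = C e + D ē` over a flux-carrying
  solution `e` on `[α, β]`: `|u v′ − u′ v|(x) = |A D − A′ C|·2|f_e|` and
  `2|f_e|·|A′||C|·(1 − |A/A′||D/C|) ≤ |u v′ − u′ v|(x)`.

Use (not here): for Carter's radial equation in the near-extremal Kerr throat, `u = u_𝓗` (cap
side, `|A/A′|` the cap reflection-with-gain) and `v = u_𝓘` (far side, `|D/C| < 1` the far
reflection), so a uniform loop-gain bound `|A/A′|·|D/C| ≤ 1 − γ` is a quantitative lower bound on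
the Wronskian, i.e. quantitative mode stability. Deliberately NOT here: the existence of a
flux-carrying `e`, any asymptotics, and the identification of the amplitudes for a specific
equation.

## References
* P. Hartman, *Ordinary Differential Equations* (SIAM Classics 38, 2002), Ch. XI §2 (Wronskian
  identities, variation of constants). Key `Hartman2002`.
* E. C. Titchmarsh, *Eigenfunction Expansions Associated with Second-Order Differential
  Equations I*, 2nd ed. (Oxford, 1962), §2.1 and §5.3 (complex solutions of a real equation,
  `W(u, ū)` and the flux `Im(ū u′)`). The algebra is folklore.
-/

noncomputable section

open Set

open scoped ComplexConjugate

namespace Literature.Analysis.ODE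

/-! ### The conjugate solution and the Wronskian of the pair -/

/-- **The conjugate of a complex solution of a real equation is a solution**: if `e′ = e'` and
`e'′ = q e` on `[α, β]` with `q` real, then `(ē)′ = conj e'` and `(conj e')′ = q ē` there.
[folklore] -/
theorem ConjugatePair.conj_sol {e e' : ℝ → ℂ} {q : ℝ → ℝ} {α β : ℝ}
    (he : ∀ x ∈ Icc α β, HasDerivAt e (e' x) x ∧ HasDerivAt e' ((q x : ℂ) * e x) x) :
    ∀ x ∈ Icc α β, HasDerivAt (fun t => conj (e t)) (conj (e' x)) x ∧
      HasDerivAt (fun t => conj (e' t)) ((q x : ℂ) * conj (e x)) x := by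
  intro x hx
  have h1 : HasDerivAt (fun t => conj (e t)) (conj (e' x)) x := (he x hx).1.star
  have h2 : HasDerivAt (fun t => conj (e' t)) (conj ((q x : ℂ) * e x)) x := (he x hx).2.star
  refine ⟨h1, h2.congr_deriv ?_⟩
  rw [map_mul, Complex.conj_ofReal]

/-- **`W(e, ē) = −2i·Im(ē e′)`**: for complex numbers `e, e'`,
`e·conj e' − e'·conj e = −2·Im(conj e · e')·i` (pure algebra). [folklore] -/
theorem ConjugatePair.wronskian_self_conj (e e' : ℂ) :
    e * conj e' - e' * conj e = -(2 * ((conj e * e').im : ℂ)) * Complex.I := by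
  apply Complex.ext
  · simp [Complex.mul_re, Complex.mul_im]
    ring
  · simp [Complex.mul_re, Complex.mul_im]
    ring

/-- **`|W(e, ē)| = 2|Im(ē e′)|`**: `‖e·conj e' − e'·conj e‖ = 2·|Im(conj e · e')|`. [folklore] -/
theorem ConjugatePair.norm_wronskian_self_conj (e e' : ℂ) :
    ‖e * conj e' - e' * conj e‖ = 2 * |(conj e * e').im| := by
  rw [ConjugatePair.wronskian_self_conj, norm_mul, Complex.norm_I, mul_one, norm_neg, norm_mul,
    Complex.norm_two, Complex.norm_real, Real.norm_eq_abs]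

/-! ### Decomposition of a complex solution over a flux-carrying conjugate pair -/

/-- **Decomposition over the conjugate pair.** Let `u` and `e` be complex solutions of the real
equation `y″ = q y` on `[α, β]` and suppose `e` carries flux at `α`, `Im(conj(e α)·e′ α) ≠ 0` (so
`W(e, ē)(α) = e ē′ − e′ ē ≠ 0`). Then for every `x ∈ [α, β]`,
`u x = A·e x + A′·conj(e x)` and `u′ x = A·e′ x + A′·conj(e′ x)` with the CONSTANT amplitudes
`A = (u ē′ − u′ ē)(α) / (e ē′ − e′ ē)(α)` and `A′ = (u′ e − u e′)(α) / (e ē′ − e′ ē)(α)`.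
Proof: the Wronskians `W(u, ē)`, `W(e, u)`, `W(e, ē)` are constant (`wronskian_complex_const`) and
`W(u, ē)·e + W(e, u)·ē = u·W(e, ē)` (resp. `… = u′·W(e, ē)` with `e′, ē′`) pointwise; no uniqueness
theorem is used. [folklore] -/
theorem ConjugatePair.decomp {u u' e e' : ℝ → ℂ} {q : ℝ → ℝ} {α β : ℝ}
    (hu : ∀ x ∈ Icc α β, HasDerivAt u (u' x) x ∧ HasDerivAt u' ((q x : ℂ) * u x) x)
    (he : ∀ x ∈ Icc α β, HasDerivAt e (e' x) x ∧ HasDerivAt e' ((q x : ℂ) * e x) x)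
    (hf : (conj (e α) * e' α).im ≠ 0) {x : ℝ} (hx : x ∈ Icc α β) :
    u x = (u α * conj (e' α) - u' α * conj (e α)) / (e α * conj (e' α) - e' α * conj (e α)) * e x +
        (u' α * e α - u α * e' α) / (e α * conj (e' α) - e' α * conj (e α)) * conj (e x) ∧
      u' x = (u α * conj (e' α) - u' α * conj (e α)) / (e α * conj (e' α) - e' α * conj (e α)) *
            e' x +
          (u' α * e α - u α * e' α) / (e α * conj (e' α) - e' α * conj (e α)) * conj (e' x) := by
  have hce := ConjugatePair.conj_sol he
  -- the three constant Wronskians `W(u, ē)`, `W(e, u)`, `W(e, ē)`, transported from `x` to `α`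
  have hA :=
    wronskian_complex_const (v := fun t => conj (e t)) (v' := fun t => conj (e' t)) hu hce hx
  have hB := wronskian_complex_const he hu hx
  have hW :=
    wronskian_complex_const (v := fun t => conj (e t)) (v' := fun t => conj (e' t)) he hce hx
  -- `W(e, ē)(α) ≠ 0` because `e` carries flux
  have hW0 : e α * conj (e' α) - e' α * conj (e α) ≠ 0 := by
    rw [ConjugatePair.wronskian_self_conj]
    exact mul_ne_zero (neg_ne_zero.2 (mul_ne_zero two_ne_zero (Complex.ofReal_ne_zero.2 hf)))
      Complex.I_ne_zero
  constructor
  · rw [div_mul_eq_mul_div, div_mul_eq_mul_div, ← add_div, eq_div_iff hW0]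
    linear_combination e x * hA + conj (e x) * hB - u x * hW
  · rw [div_mul_eq_mul_div, div_mul_eq_mul_div, ← add_div, eq_div_iff hW0]
    linear_combination e' x * hA + conj (e' x) * hB - u' x * hW

/-! ### Flux and Wronskian of combinations (pure algebra) -/

/-- **Flux of a combination over the conjugate pair**: for complex `A, A′, e, e'`,
`Im(conj(A e + A′ conj e)·(A e' + A′ conj e')) = (‖A‖² − ‖A′‖²)·Im(conj e · e')` — the cross terms
`conj A·A′·conj(e e')` and `conj A′·A·e e'` are complex conjugate and the `ē`-wave carries the
opposite flux. [folklore] -/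
theorem ConjugatePair.flux_decomp (A A' e e' : ℂ) :
    (conj (A * e + A' * conj e) * (A * e' + A' * conj e')).im =
      (‖A‖ ^ 2 - ‖A'‖ ^ 2) * (conj e * e').im := by
  simp only [map_add, map_mul, Complex.conj_conj, Complex.add_im, Complex.mul_im, Complex.mul_re,
    Complex.add_re, Complex.conj_re, Complex.conj_im, Complex.sq_norm, Complex.normSq_apply]
  ring

/-- **Gain of the amplitude ratio from the flux**: if `Im(conj e · e') = f ≠ 0`, the combination
`A e + A′ conj e` has flux `F` (in the sense of `flux_decomp`) and `A′ ≠ 0`, then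
`‖A / A′‖² = 1 + F / (f·‖A′‖²)`; in particular `‖A / A′‖ > 1` iff `F` has the sign of `f`
("reflection with gain"). [folklore] -/
theorem ConjugatePair.gain_sq_eq (A A' e e' : ℂ) {f F : ℝ} (hf : (conj e * e').im = f)
    (hF : (conj (A * e + A' * conj e) * (A * e' + A' * conj e')).im = F) (hf0 : f ≠ 0)
    (hA' : A' ≠ 0) : ‖A / A'‖ ^ 2 = 1 + F / (f * ‖A'‖ ^ 2) := by
  rw [ConjugatePair.flux_decomp, hf] at hF
  have hA'n : ‖A'‖ ≠ 0 := norm_ne_zero_iff.2 hA'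
  rw [norm_div, div_pow, ← hF]
  field_simp
  ring

/-- **Reflection coefficient from the flux**: if `Im(conj e · e') = f ≠ 0`, the combination
`C e + D conj e` has flux `G` and `C ≠ 0`, then `‖D / C‖² = 1 − G / (f·‖C‖²)`; in particular
`‖D / C‖ < 1` iff `G` has the sign of `f`. [folklore] -/
theorem ConjugatePair.reflection_sq_eq (C D e e' : ℂ) {f G : ℝ} (hf : (conj e * e').im = f)
    (hG : (conj (C * e + D * conj e) * (C * e' + D * conj e')).im = G) (hf0 : f ≠ 0)
    (hC : C ≠ 0) : ‖D / C‖ ^ 2 = 1 - G / (f * ‖C‖ ^ 2) := by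
  rw [ConjugatePair.flux_decomp, hf] at hG
  have hCn : ‖C‖ ≠ 0 := norm_ne_zero_iff.2 hC
  rw [norm_div, div_pow, ← hG]
  field_simp
  ring

/-- **Wronskian of two combinations over the conjugate pair**: for complex `A, A′, C, D, e, e'`,
`(A e + A′ ē)(C e' + D ē') − (A e' + A′ ē')(C e + D ē) = (A D − A′ C)·(e ē' − e' ē)` with
`ē = conj e`, `ē' = conj e'` (pure algebra; the conjugate-pair instance of
`wronskian_of_combinations`). [folklore] -/
theorem ConjugatePair.wronskian_decomp (A A' C D e e' : ℂ) :
    (A * e + A' * conj e) * (C * e' + D * conj e') -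
        (A * e' + A' * conj e') * (C * e + D * conj e) =
      (A * D - A' * C) * (e * conj e' - e' * conj e) := by
  ring

/-- **Norm of the Wronskian of two combinations**:
`‖(A e + A′ ē)(C e' + D ē') − (A e' + A′ ē')(C e + D ē)‖ = ‖A D − A′ C‖·(2·|Im(conj e · e')|)`.
[folklore] -/
theorem ConjugatePair.norm_wronskian_decomp (A A' C D e e' : ℂ) :
    ‖(A * e + A' * conj e) * (C * e' + D * conj e') -
        (A * e' + A' * conj e') * (C * e + D * conj e)‖ =
      ‖A * D - A' * C‖ * (2 * |(conj e * e').im|) := by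
  rw [ConjugatePair.wronskian_decomp, norm_mul, ConjugatePair.norm_wronskian_self_conj]

/-! ### The small-gain lower bound for `‖A D − A′ C‖` -/

/-- **Triangle lower bounds for the amplitude determinant**: for complex `A, A′, C, D`,
`‖A′‖‖C‖ − ‖A‖‖D‖ ≤ ‖A D − A′ C‖` and `‖A‖‖D‖ − ‖A′‖‖C‖ ≤ ‖A D − A′ C‖`. [folklore] -/
theorem ConjugatePair.norm_det_ge (A A' C D : ℂ) :
    ‖A'‖ * ‖C‖ - ‖A‖ * ‖D‖ ≤ ‖A * D - A' * C‖ ∧ ‖A‖ * ‖D‖ - ‖A'‖ * ‖C‖ ≤ ‖A * D - A' * C‖ := by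
  constructor
  · have h := norm_sub_norm_le (A' * C) (A * D)
    rwa [norm_mul, norm_mul, norm_sub_rev] at h
  · have h := norm_sub_norm_le (A * D) (A' * C)
    rwa [norm_mul, norm_mul] at h

/-- **Small-gain lower bound.** For complex `A, A′, C, D` with `A′ ≠ 0`, `C ≠ 0`:
`‖A′‖·‖C‖·(1 − ‖A / A′‖·‖D / C‖) ≤ ‖A D − A′ C‖` — if the "loop gain" `‖A/A′‖·‖D/C‖` is below `1`,
the determinant is bounded below by the gap times `‖A′‖‖C‖`. [folklore] -/
theorem ConjugatePair.small_gain (A A' C D : ℂ) (hA' : A' ≠ 0) (hC : C ≠ 0) :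
    ‖A'‖ * ‖C‖ * (1 - ‖A / A'‖ * ‖D / C‖) ≤ ‖A * D - A' * C‖ := by
  have hA'n : ‖A'‖ ≠ 0 := norm_ne_zero_iff.2 hA'
  have hCn : ‖C‖ ≠ 0 := norm_ne_zero_iff.2 hC
  have h : ‖A'‖ * ‖C‖ * (1 - ‖A / A'‖ * ‖D / C‖) = ‖A'‖ * ‖C‖ - ‖A‖ * ‖D‖ := by
    rw [norm_div, norm_div]
    field_simp
  rw [h]
  exact (ConjugatePair.norm_det_ge A A' C D).1

/-! ### Applied forms for solutions on `[α, β]` -/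

/-- **Flux of a solution through its amplitudes.** Under the hypotheses of `ConjugatePair.decomp`,
with `A, A′` the amplitudes of `u` over `e, ē`:
`Im(conj(u x)·u′ x) = (‖A‖² − ‖A′‖²)·Im(conj(e α)·e′ α)` for every `x ∈ [α, β]` (both fluxes are
constant). [folklore] -/
theorem ConjugatePair.flux_eq {u u' e e' : ℝ → ℂ} {q : ℝ → ℝ} {α β : ℝ}
    (hu : ∀ x ∈ Icc α β, HasDerivAt u (u' x) x ∧ HasDerivAt u' ((q x : ℂ) * u x) x)
    (he : ∀ x ∈ Icc α β, HasDerivAt e (e' x) x ∧ HasDerivAt e' ((q x : ℂ) * e x) x)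
    (hf : (conj (e α) * e' α).im ≠ 0) {A A' : ℂ}
    (hA : A = (u α * conj (e' α) - u' α * conj (e α)) / (e α * conj (e' α) - e' α * conj (e α)))
    (hA' : A' = (u' α * e α - u α * e' α) / (e α * conj (e' α) - e' α * conj (e α)))
    {x : ℝ} (hx : x ∈ Icc α β) :
    (conj (u x) * u' x).im = (‖A‖ ^ 2 - ‖A'‖ ^ 2) * (conj (e α) * e' α).im := by
  obtain ⟨h0, h1⟩ := ConjugatePair.decomp hu he hf hx
  rw [← hA, ← hA'] at h0 h1
  rw [h0, h1, ConjugatePair.flux_decomp, flux_const he hx]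

/-- **The Wronskian of two solutions through their amplitudes.** Let `u, v, e` be complex solutions
of the real equation `y″ = q y` on `[α, β]`, `e` carrying flux `f_e = Im(conj(e α)·e′ α) ≠ 0`, and
let `A, A′` (resp. `C, D`) be the amplitudes of `u` (resp. `v`) over `e, ē` as in
`ConjugatePair.decomp`. Then `‖u x·v′ x − u′ x·v x‖ = ‖A D − A′ C‖·2|f_e|` at every `x ∈ [α, β]`.
[folklore] -/
theorem ConjugatePair.norm_wronskian_eq {u u' v v' e e' : ℝ → ℂ} {q : ℝ → ℝ} {α β : ℝ}
    (hu : ∀ x ∈ Icc α β, HasDerivAt u (u' x) x ∧ HasDerivAt u' ((q x : ℂ) * u x) x)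
    (hv : ∀ x ∈ Icc α β, HasDerivAt v (v' x) x ∧ HasDerivAt v' ((q x : ℂ) * v x) x)
    (he : ∀ x ∈ Icc α β, HasDerivAt e (e' x) x ∧ HasDerivAt e' ((q x : ℂ) * e x) x)
    (hf : (conj (e α) * e' α).im ≠ 0) {A A' C D : ℂ}
    (hA : A = (u α * conj (e' α) - u' α * conj (e α)) / (e α * conj (e' α) - e' α * conj (e α)))
    (hA' : A' = (u' α * e α - u α * e' α) / (e α * conj (e' α) - e' α * conj (e α)))
    (hC : C = (v α * conj (e' α) - v' α * conj (e α)) / (e α * conj (e' α) - e' α * conj (e α)))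
    (hD : D = (v' α * e α - v α * e' α) / (e α * conj (e' α) - e' α * conj (e α)))
    {x : ℝ} (hx : x ∈ Icc α β) :
    ‖u x * v' x - u' x * v x‖ = ‖A * D - A' * C‖ * (2 * |(conj (e α) * e' α).im|) := by
  obtain ⟨hu0, hu1⟩ := ConjugatePair.decomp hu he hf hx
  obtain ⟨hv0, hv1⟩ := ConjugatePair.decomp hv he hf hx
  rw [← hA, ← hA'] at hu0 hu1
  rw [← hC, ← hD] at hv0 hv1
  rw [hu0, hu1, hv0, hv1, ConjugatePair.norm_wronskian_decomp, flux_const he hx]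

/-- **Small-gain lower bound for the Wronskian of two solutions.** Under the hypotheses of
`ConjugatePair.norm_wronskian_eq`, if moreover `A′ ≠ 0` and `C ≠ 0`, then at every `x ∈ [α, β]`
`2|f_e|·‖A′‖‖C‖·(1 − ‖A / A′‖·‖D / C‖) ≤ ‖u x·v′ x − u′ x·v x‖` (`f_e = Im(conj(e α)·e′ α)`): a loop
gain `‖A/A′‖·‖D/C‖` uniformly below `1` is a quantitative lower bound for the Wronskian.
[folklore] -/
theorem ConjugatePair.norm_wronskian_ge_small_gain {u u' v v' e e' : ℝ → ℂ} {q : ℝ → ℝ} {α β : ℝ}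
    (hu : ∀ x ∈ Icc α β, HasDerivAt u (u' x) x ∧ HasDerivAt u' ((q x : ℂ) * u x) x)
    (hv : ∀ x ∈ Icc α β, HasDerivAt v (v' x) x ∧ HasDerivAt v' ((q x : ℂ) * v x) x)
    (he : ∀ x ∈ Icc α β, HasDerivAt e (e' x) x ∧ HasDerivAt e' ((q x : ℂ) * e x) x)
    (hf : (conj (e α) * e' α).im ≠ 0) {A A' C D : ℂ}
    (hA : A = (u α * conj (e' α) - u' α * conj (e α)) / (e α * conj (e' α) - e' α * conj (e α)))
    (hA' : A' = (u' α * e α - u α * e' α) / (e α * conj (e' α) - e' α * conj (e α)))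
    (hC : C = (v α * conj (e' α) - v' α * conj (e α)) / (e α * conj (e' α) - e' α * conj (e α)))
    (hD : D = (v' α * e α - v α * e' α) / (e α * conj (e' α) - e' α * conj (e α)))
    (hA'0 : A' ≠ 0) (hC0 : C ≠ 0) {x : ℝ} (hx : x ∈ Icc α β) :
    2 * |(conj (e α) * e' α).im| * (‖A'‖ * ‖C‖ * (1 - ‖A / A'‖ * ‖D / C‖)) ≤
      ‖u x * v' x - u' x * v x‖ := by
  rw [ConjugatePair.norm_wronskian_eq hu hv he hf hA hA' hC hD hx, mul_comm]
  exact mul_le_mul_of_nonneg_right (ConjugatePair.small_gain A A' C D hA'0 hC0) (by positivity)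

end Literature.Analysis.ODE

end
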